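import Literature.Computability.Complexity.FoldBricks
import Literature.Computability.Complexity.LengthCompare
import HarnessLib

/-!
# Parameters of the `PP` refuter: the level below a padding length, in unary, in `FP`

Topic `Computability/MetaComplexity` (refuters for `PP`, Chen–Jin–Santhanam–Williams [ChenEtAl2022],
§5.3 with §5.1 Lemma 6), machine layer, part 1. The refuter receives `1ᴺ` and must output strings
of length exactly `N`; its queries are padded to length `N` ("by padding, we assume the input
strings received by `A` have length exactly `ℓ(n)`, for some strictly increasing polynomial `ℓ`",
[ChenEtAl2022, §5.3]), so it works at the LEVEL `n = ℓ⁻¹(N)`. Lemma 6 of [ChenEtAl2022] ("the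
algorithm that prints `x⁽ⁱ⁾ₙ` on input `1^{ℓ⁽ⁱ⁾(n)}` … is well-defined because `ℓ⁽ⁱ⁾(n)` is strictly
increasing (and hence injective)") needs this inverse in polynomial time. We take the total
version `pinv P N = max {i ≤ N | P(i) ≤ N}` (`Nat.findGreatest`), which inverts a strictly
increasing `P` with `P(i) ≥ i` on its range (`pinv_eval`), and compute it in `FP` on unary input as a
counted fold (`FoldBricks.lean`): `invF P z = 1^{pinv P |z|}` (`invF_apply`, `invF_mem_FP`).

From it, the unary parameter functions of the refuter (`nF` level, `mF = p(n)` witness length,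
`d0F = p(n) + 2` search width, `dmF` descent depth `n + p(n) + 3(p(n)+2)`), each with its value
(`*_apply`) and `FP` membership.

## References

* L. Chen, C. Jin, R. Santhanam, R. Williams, *Constructive separations and their consequences*,
  FOCS 2021 = TheoretiCS 3 (2024), §5.1 (Lemma 6 and its proof), §5.3 [ChenEtAl2022].
* S. Arora, B. Barak, *Computational Complexity: A Modern Approach*, CUP 2009, §1.3 (bounded loops
  in polynomial time) [AroraBarak2009].
-/

noncomputable section

namespace Literature.Computability.MetaComplexity

open _root_.Computability Polynomial Literature.Computability.Complexity
  Literature.Computability.Complexity.Brick Literature.Computability.Complexity.Plumb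

namespace PPRefuter

/-! ### The level below a padding length -/

section Inversion

variable (P : Polynomial ℕ)

/-- **The level of a padding length**: `pinv P N = max {i ≤ N | P(i) ≤ N}` (and `0` if there is no
such `i`). For a strictly increasing `P` with `P(i) ≥ i` this inverts `P` on its range. The `n` with
`ℓ(n) = N` of [ChenEtAl2022, §5.1, proof of Lemma 6]. [cite: ChenEtAl2022, §5.1 (proof of Lemma 6)] -/
def pinv (N : ℕ) : ℕ := Nat.findGreatest (fun i => P.eval i ≤ N) N

/-- `pinv P N ≤ N`. [folklore] -/
theorem pinv_le (N : ℕ) : pinv P N ≤ N := Nat.findGreatest_le _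

/-- If `P(0) ≤ N` then `P (pinv P N) ≤ N`. [folklore] -/
theorem eval_pinv_le {N : ℕ} (h : P.eval 0 ≤ N) : P.eval (pinv P N) ≤ N :=
  Nat.findGreatest_spec (P := fun i => P.eval i ≤ N) (Nat.zero_le N) h

/-- Levels above `pinv P N` (up to `N`) are too big. [folklore] -/
theorem lt_eval_of_pinv_lt {N i : ℕ} (hi : pinv P N < i) (hiN : i ≤ N) : N < P.eval i :=
  Nat.lt_of_not_le (Nat.findGreatest_is_greatest (P := fun j => P.eval j ≤ N) hi hiN)

/-- **Inversion on the range**: for `P` strictly increasing with `P(i) ≥ i`, `pinv P (P n) = n`.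
("`ℓ⁽ⁱ⁾(n)` is strictly increasing (and hence injective)", [ChenEtAl2022, §5.1].)
[cite: ChenEtAl2022, §5.1 (proof of Lemma 6)] -/
theorem pinv_eval (hmono : StrictMono fun i => P.eval i) (hge : ∀ i, i ≤ P.eval i) (n : ℕ) :
    pinv P (P.eval n) = n := by
  refine le_antisymm ?_ (Nat.le_findGreatest (hge n) le_rfl)
  by_contra h
  have hlt : n < pinv P (P.eval n) := Nat.lt_of_not_le h
  have h1 : P.eval n < P.eval (pinv P (P.eval n)) := hmono hlt
  have h2 := eval_pinv_le P (N := P.eval n) (by simpa using (hmono.monotone (Nat.zero_le n)))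
  omega

/-! #### The brick -/

/-- The piece of round `i` on `⟨z, 1ⁱ⟩`: `⟨[P(i) ≤ |z|], 1ⁱ⟩`. [folklore] -/
def invPiece : List Bool → List Bool := fanoutFn (lenLeFn X ∘ fanoutFn fstF (polyFn P ∘ sndF)) sndF

/-- The fold operation on `⟨acc, ⟨[b], 1ⁱ⟩⟩`: `1ⁱ` if `b`, else `acc`. [folklore] -/
def invOp : List Bool → List Bool := iteFn (HashBricks.headBitFn ∘ fstF ∘ sndF) (sndF ∘ sndF) fstF

/-- The initial record `⟨z, ⟨encodeNat (|z| + 1), ⟨1⁰, []⟩⟩⟩` (`|z| + 1` rounds, `i = 0, …, |z|`). [folklore] -/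
def invInit : List Bool → List Bool :=
  fanoutFn id (fanoutFn (lenBinF ∘ List.cons true) (fun _ => boolPair [] []))

/-- **`invF P z = 1^{pinv P |z|}`**: the level, in unary, by a counted fold over `i = 0, …, |z|`.
[cite: ChenEtAl2022, §5.1 (proof of Lemma 6)] -/
def invF : List Bool → List Bool := sndPow 2 ∘ foldLoop (invOp) (clipF 4 (invPiece P)) (X + 1) ∘ invInit

variable {P}

/-- Value of the piece. [folklore] -/
theorem invPiece_apply (z : List Bool) (i : ℕ) :
    invPiece P (boolPair z (ones i)) = boolPair [decide (P.eval i ≤ z.length)] (ones i) := by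
  simp [invPiece, lenLeFn_boolPair]

/-- Value of the fold operation. [folklore] -/
theorem invOp_apply (acc : List Bool) (b : Bool) (u : List Bool) :
    invOp (boolPair acc (boolPair [b] u)) = if b then u else acc := by
  have hc : (HashBricks.headBitFn ∘ fstF ∘ sndF) (boolPair acc (boolPair [b] u)) = [b] := by simp
  cases b
  · rw [invOp, iteFn_apply_false hc]; simp
  · rw [invOp, iteFn_apply_true hc]; simp

/-- Growth of the fold operation. [folklore] -/
theorem length_invOp_le (w : List Bool) : (invOp w).length ≤ (fstF w).length + (sndF w).length + 0 := by
  rw [invOp, iteFn_of_oneBit (HashBricks.oneBit_headBitFn.comp _)]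
  split_ifs
  · have := length_fstF_sndF_le (sndF w); simp only [Function.comp_apply]; omega
  · omega

/-- The model of the fold is `Nat.findGreatest`. [folklore] -/
theorem foldAcc_invOp (z : List Bool) : ∀ k : ℕ,
    foldAcc invOp (invPiece P) z 0 (k + 1) [] = ones (Nat.findGreatest (fun i => P.eval i ≤ z.length) k)
  | 0 => by
    rw [foldAcc_succ', foldAcc_zero, Nat.zero_add, invPiece_apply, invOp_apply, Nat.findGreatest_zero]
    split_ifs <;> rfl
  | k + 1 => by
    rw [foldAcc_succ', foldAcc_invOp z k, Nat.zero_add, invPiece_apply, invOp_apply, Nat.findGreatest_succ]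
    by_cases h : P.eval (k + 1) ≤ z.length
    · rw [decide_eq_true h, if_pos rfl, if_pos h]
    · rw [decide_eq_false h, if_neg h]; rfl

/-- **`invF P z = 1^{pinv P |z|}`.** [cite: ChenEtAl2022, §5.1 (proof of Lemma 6)] -/
theorem invF_apply (z : List Bool) : invF P z = ones (pinv P z.length) := by
  have hinit : invInit z = boolPair z (boolPair (encodeNat (z.length + 1)) (boolPair (ones 0) [])) := by
    simp [invInit]
  have hk : z.length + 1 ≤ (X + 1 : Polynomial ℕ).eval z.length := by simp
  have hclip : foldAcc invOp (clipF 4 (invPiece P)) z 0 (z.length + 1) [] = foldAcc invOp (invPiece P) z 0 (z.length + 1) [] :=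
    foldAcc_clipF fun j _ hj => by
      rw [invPiece_apply, length_boolPair, List.length_singleton, List.length_replicate]; omega
  rw [invF, Function.comp_apply, Function.comp_apply, hinit, foldLoop_apply _ _ hk, hclip, foldAcc_invOp]
  simp [pinv]

/-- **`invF P ∈ FP`.** [cite: AroraBarak2009, §1.3 (bounded loops)] -/
theorem invF_mem_FP : invF P ∈ FP := by
  have hpiece : invPiece P ∈ FP := fanoutFn_mem_FP
    (comp_mem_FP (lenLeFn_mem_FP X) (fanoutFn_mem_FP fstF_mem_FP (comp_mem_FP (polyFn_mem_FP P) sndF_mem_FP))) sndF_mem_FP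
  have hop : invOp ∈ FP := iteFn_mem_FP (comp_mem_FP HashBricks.headBitFn_mem_FP (comp_mem_FP fstF_mem_FP sndF_mem_FP))
    (comp_mem_FP sndF_mem_FP sndF_mem_FP) fstF_mem_FP
  have hinit : invInit ∈ FP := fanoutFn_mem_FP OracleCompose.id_mem_FP
    (fanoutFn_mem_FP (comp_mem_FP lenBinF_mem_FP (cons_mem_FP true)) (const_mem_FP _))
  exact comp_mem_FP (sndPow_mem_FP 2) (comp_mem_FP (foldLoop_clipF_mem_FP 4 hop length_invOp_le hpiece (X + 1)) hinit)

end Inversion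

/-! ### The unary parameters of the refuter -/

section Params

variable (p PT : Polynomial ℕ)

/-- The level `n = pinv PT N` of the input `1ᴺ` (any `z` of length `N`), in unary. [cite: ChenEtAl2022, §5.3 (proof of Thm. 6)] -/
def nF : List Bool → List Bool := invF PT

/-- The witness length `m = p(n)` at the level, in unary. [cite: ChenEtAl2022, §5.3 (proof of Thm. 6)] -/
def mF : List Bool → List Bool := polyFn p ∘ nF PT

/-- The search width `D₀ = p(n) + 2`, in unary. [cite: ChenEtAl2022, §5.3 (proof of Thm. 6)] -/
def d0F : List Bool → List Bool := List.cons true ∘ List.cons true ∘ mF p PT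

/-- The descent depth `n + p(n) + 3 D₀` (the length of a full witness `x u τᵤ τ₀ τ₁`), in unary.
[cite: ChenEtAl2022, §5.3 (proof of Thm. 6)] -/
def dmF : List Bool → List Bool :=
  fun z => nF PT z ++ (mF p PT z ++ (d0F p PT z ++ (d0F p PT z ++ d0F p PT z)))

/-- The numeric level. [folklore] -/
def lev (N : ℕ) : ℕ := pinv PT N

/-- The numeric depth `n + p(n) + 3(p(n)+2)`. [folklore] -/
def depth (N : ℕ) : ℕ := lev PT N + p.eval (lev PT N) + 3 * (p.eval (lev PT N) + 2)

variable {p PT}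

/-- `nF z = 1ⁿ`. [folklore] -/
@[simp] theorem nF_apply (z : List Bool) : nF PT z = ones (lev PT z.length) := invF_apply z

/-- `mF z = 1^{p(n)}`. [folklore] -/
@[simp] theorem mF_apply (z : List Bool) : mF p PT z = ones (p.eval (lev PT z.length)) := by
  simp [mF]

/-- `d0F z = 1^{p(n)+2}`. [folklore] -/
@[simp] theorem d0F_apply (z : List Bool) : d0F p PT z = ones (p.eval (lev PT z.length) + 2) := by
  simp [d0F, ones, List.replicate_succ]

/-- `dmF z = 1^{depth}`. [folklore] -/
@[simp] theorem dmF_apply (z : List Bool) : dmF p PT z = ones (depth p PT z.length) := by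
  simp only [dmF, nF_apply, mF_apply, d0F_apply, ones, ← List.replicate_add, depth]
  congr 1; ring

/-- `nF ∈ FP`. [folklore] -/
theorem nF_mem_FP : nF PT ∈ FP := invF_mem_FP

/-- `mF ∈ FP`. [folklore] -/
theorem mF_mem_FP : mF p PT ∈ FP := comp_mem_FP (polyFn_mem_FP p) nF_mem_FP

/-- `d0F ∈ FP`. [folklore] -/
theorem d0F_mem_FP : d0F p PT ∈ FP := comp_mem_FP (cons_mem_FP true) (comp_mem_FP (cons_mem_FP true) mF_mem_FP)

/-- `dmF ∈ FP`. [folklore] -/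
theorem dmF_mem_FP : dmF p PT ∈ FP :=
  append_mem_FP nF_mem_FP (append_mem_FP mF_mem_FP (append_mem_FP d0F_mem_FP (append_mem_FP d0F_mem_FP d0F_mem_FP)))

/-- The level is at most the padding length. [folklore] -/
theorem lev_le (N : ℕ) : lev PT N ≤ N := pinv_le PT N

end Params

end PPRefuter

end Literature.Computability.MetaComplexity

end
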